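import Summits.Ventures.PackingBounds.ThreePointCert.C9ECertC

/-!
# A(9, arccos 1/3) ≤ 98: kernel instance of the exact value-99 three-point certificate — kernel validation of sum-of-squares rows (file 21)

Framing: lottery ticket; floor = certified bounds/negative ranges. Venture `PackingBounds` (cell
`pub-packcert`), three-point SDP family. Integer data of the EXACT (slack-free) Bachoc–Vallentin
certificate of value exactly `99` for `A(9, arccos 1/3)` (n = 9, s = 1/3, degree 10, symmetric sums of
squares, `B = 0`; every block on its optimal face), produced by `pub-packcert-lp` gen 4 (`code/k99/job4.py`,
strategy S4_a_R0rest_F) from the cell's exact certificate `sdp-n9-d10-s1-3-sym-exact99-r2.json` (pub-packcert-sdp gen 4;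
two independent exact verifiers + referee), in the units of the kernel checker `ThreePointCert.CheckExact`
(soundness `ThreePointCert.SoundExact`, `SoundExact2`). Generated file: plain lists of integers / monomials.
-/

namespace Summit.Ventures.PackingBounds.ThreePointCert.C9E

open Literature.Geometry.DiscreteGeometry Literature.Geometry.DiscreteGeometry.PolyCert PolyCert.SPoly

set_option maxHeartbeats 0 in
/-- Part `pR0std`: rows [52, 56) added to `d0_20` give `d0_21` (kernel; est. 14960 term products). -/
theorem ok_pR0std_12 : partChunkOK pR0std 52 4 d0_20 d0_21 = true := by
  decide +kernel

end Summit.Ventures.PackingBounds.ThreePointCert.C9E
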